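import Summits.KontsevichZagierPeriods.KontsevichZagierPeriods.Theorems.RootDecompWalshStrataBall4Disc
import Summits.KontsevichZagierPeriods.KontsevichZagierPeriods.Theorems.RootDecompQuadraticDescentLegendreData
import Literature.NumberTheory.Transcendental.LindemannWeierstrassProofs
import Literature.NumberTheory.Transcendental.KZRulesAssociator
import Literature.NumberTheory.Transcendental.KZProductIdeal
import Literature.NumberTheory.Transcendental.KZRelationsLE

/-!
# The `π`-polynomial sector of the weight-two wall: Conjecture 1 (kernel form) PROVED on it

Route `RootDecompWalshStrata` (cell decomp-kz, lens 4, gen 12), support toward `QuadricSignKernel`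
(item stmt-KontsevichZagierPeriods-25393), slice `d = 4`.  The gen-11 node reads
`QuadricFour ⟸ RationalTwoKernel ∧ QuadricTwoDescent`: the weight-ONE cells are decided by Baker
(`PiBox.Dlog`, tree), the weight-TWO cells (4-ball `q·π²/32`, split quadric `q(π²/12 − 3/4)`) were left to
the ORACLE `RationalTwoKernel` / `DecomposableTwoKernel`.  This file removes the oracle on the part of the
wall the uncut `d = 4` specimens reach: the **`π`-POLYNOMIAL SECTOR**
`Π = ⟨[pt, a], [(0,1), b·dt/(1+t²)], [(0,1)², c·dx dy/((1+x²)(1+y²))]⟩` (rational constants, rational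
multiples of the arc `π/4`, rational multiples of the arc SQUARED `π²/16`), values `ℚ + ℚπ + ℚπ²`.
MAIN THEOREM `piKernel`: **every `ℤ`-combination in `Π` with value `0` lies in `KZ.relations`** —
UNCONDITIONALLY: integrand additivity brings any element to the normal form
`[pt, a] + [(0,1), b/(1+t²)] + [(0,1)², c/((1+x²)(1+y²))]` (`exists_normalForm`), whose value is
`a + bπ/4 + cπ²/16` (`eval_piNF`), and `a = b = c = 0` by the TRANSCENDENCE OF `π`
(`Literature…transcendental_pi_holds`, Lindemann): the zero normal form is three zero representations,
a relation.  The sibling files descend the 4-ball (`Ball4Pi`), the solid paraboloid and the Lorentzian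
cone (gen 11, `arcRep ≡ hqRep` of `ArcBridge`) INTO `Π` inside the three rules, and the split quadric
into `Π` given Euler's accessible identity (`Split4Euler`), so that the kernel statement of item 25393
holds OUTRIGHT for every family drawn from the ball / paraboloid / cone genera (`PiFourRung`).
0 sorry.  [KontsevichZagier2001 §1.1–§1.2; Lindemann1882 via BakerTNT1975 Thm 1.3; this node]
-/

noncomputable section

open Literature.NumberTheory.Transcendental
open MeasureTheory Set
open MvPolynomial (aeval X C)
open Literature.ModelTheory.ExponentialFields (IsSemialgebraic)
open Summit.KontsevichZagierPeriods.RootDecompWalshStrata.Ball4 (ivSet isSemialgebraic_ivSet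
  ivSet_subset_Icc)
open Summit.KontsevichZagierPeriods.KontsevichZagierPeriods.Theorems.RootDecompQuadraticDescentLegendre
  (I1 measurableSet_I1 setIntegral_I1 integrableOn_I1_of integrableOn_Ioo_of_continuous)

namespace Summit.KontsevichZagierPeriods.RootDecompWalshStrata.PiSector

/-- A rational number is algebraic over `ℚ` (as a real number). [folklore] -/
private theorem isAlgebraic_rat (q : ℚ) : IsAlgebraic ℚ ((q : ℚ) : ℝ) := by
  simpa using isAlgebraic_algebraMap (R := ℚ) (A := ℝ) q

/-! #### The constant generator `cstRep a = [pt, a]` (value `a`) -/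

/-- `cstRep a = [pt, a]`: the `0`-dimensional representation of the rational constant `a`
(the tree's unit representation scaled by `a`). [KontsevichZagier2001 §1.1] -/
def cstRep (a : ℚ) : KZ.IntegralRep 0 := KZ.IntegralRep.unit.constMul (a : ℝ) (isAlgebraic_rat a)

/-- The domain of `[pt, a]` is `ℝ⁰`. [definition] -/
@[simp] theorem cstRep_domain (a : ℚ) : (cstRep a).domain = univ := rfl

/-- The integrand of `[pt, a]`. [definition] -/
@[simp] theorem cstRep_integrand (a : ℚ) (x : Fin 0 → ℝ) : (cstRep a).integrand x = (a : ℝ) := by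
  simp [cstRep]

/-- **`value [pt, a] = a`.** [KontsevichZagier2001 §1.1] -/
theorem value_cstRep (a : ℚ) : (cstRep a).value = a := by
  rw [cstRep, KZ.IntegralRep.value_constMul, KZ.IntegralRep.value_unit, mul_one]

/-- Integrand additivity for constants: `[pt, a₁+a₂] − [pt, a₁] − [pt, a₂]` is ONE move. [KontsevichZagier2001 §1.2 rule (1)] -/
theorem of_cstRep_add (a₁ a₂ : ℚ) :
    KZ.of (cstRep (a₁ + a₂)) - KZ.of (cstRep a₁) - KZ.of (cstRep a₂) ∈ KZ.relations :=
  KZ.integrandAddRel_subset_relations ⟨0, cstRep (a₁ + a₂), cstRep a₁, cstRep a₂, rfl, rfl,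
    fun x _ => by simp only [cstRep_integrand, Pi.add_apply, Rat.cast_add], rfl⟩

/-! #### The arc generator `hqRep b = [(0,1), b/(1+t²)]` (value `b·π/4`) -/

/-- The lineage's unit interval `ivSet` is the interval `I1` of the Legendre files. [definition] -/
theorem ivSet_eq_I1 : ivSet = I1 := by
  ext t
  simp only [ivSet, I1, mem_setOf_eq, mem_Ioo, Fin.forall_fin_one]

/-- `hqRep b = [(0,1), b·dt/(1+t²)]`: the rational arc with weight `b` (value `b·π/4`).
[KontsevichZagier2001 §1.1] -/
def hqRep (b : ℚ) : KZ.IntegralRep 1 where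
  domain := ivSet
  integrand t := (b : ℝ) / (1 + t 0 ^ 2)
  isSemialgebraic_domain := isSemialgebraic_ivSet
  isSemialgebraicFunOn_integrand :=
    (isSemialgebraicFunOn_aeval_div_aeval isSemialgebraic_ivSet (C b) (1 + X 0 ^ 2)
      fun t _ => by simp; positivity).congr fun t _ => by simp
  integrableOn := by
    have hc : Continuous fun u : ℝ => (b : ℝ) / (1 + u ^ 2) :=
      continuous_const.div (by fun_prop) fun u => by positivity
    have h := integrableOn_I1_of (f := fun u : ℝ => (b : ℝ) / (1 + u ^ 2))
      (integrableOn_Ioo_of_continuous hc)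
    rw [← ivSet_eq_I1] at h
    exact h

/-- The domain of `hqRep b`. [definition] -/
@[simp] theorem hqRep_domain (b : ℚ) : (hqRep b).domain = ivSet := rfl

/-- The integrand of `hqRep b`. [definition] -/
@[simp] theorem hqRep_integrand (b : ℚ) (t : Fin 1 → ℝ) :
    (hqRep b).integrand t = (b : ℝ) / (1 + t 0 ^ 2) := rfl

/-- **`hqRep b` is a rational representation of dimension 1.** [KontsevichZagier2001 §1.1] -/
theorem isRational_hqRep (b : ℚ) : (hqRep b).IsRational :=
  ⟨C b, 1 + X 0 ^ 2, fun t _ => by simp; positivity, fun t _ => by simp⟩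

/-- `∫₀¹ b·dt/(1+t²) = b·π/4`. [folklore] -/
theorem integral_hq_Ioo (b : ℝ) : ∫ x in Ioo (0:ℝ) 1, b / (1 + x ^ 2) = b * (Real.pi / 4) := by
  rw [← integral_Ioc_eq_integral_Ioo, ← intervalIntegral.integral_of_le zero_le_one]
  have e : (fun x : ℝ => b / (1 + x ^ 2)) = fun x => b * (1 + x ^ 2)⁻¹ := by
    funext x; rw [div_eq_mul_inv]
  rw [e, intervalIntegral.integral_const_mul, integral_inv_one_add_sq, Real.arctan_one,
    Real.arctan_zero, sub_zero]

/-- **`value (hqRep b) = b·π/4`.** [KontsevichZagier2001 §1.1] -/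
theorem value_hqRep (b : ℚ) : (hqRep b).value = (b : ℝ) * (Real.pi / 4) := by
  rw [KZ.IntegralRep.value, hqRep_domain, ivSet_eq_I1, ← integral_hq_Ioo, ← setIntegral_I1]
  exact setIntegral_congr_fun measurableSet_I1 fun t _ => rfl

/-- Integrand additivity: `[(0,1),(b₁+b₂)h] − [(0,1),b₁h] − [(0,1),b₂h]` is ONE move. [KontsevichZagier2001 §1.2 rule (1)] -/
theorem of_hqRep_add (b₁ b₂ : ℚ) :
    KZ.of (hqRep (b₁ + b₂)) - KZ.of (hqRep b₁) - KZ.of (hqRep b₂) ∈ KZ.relations :=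
  KZ.integrandAddRel_subset_relations ⟨1, hqRep (b₁ + b₂), hqRep b₁, hqRep b₂, rfl, rfl,
    fun t _ => by simp only [hqRep_integrand, Pi.add_apply, Rat.cast_add]; ring, rfl⟩

/-! #### The square generator `hq2Rep c = [(0,1)², c/((1+x²)(1+y²))]` (value `c·π²/16`) -/

/-- `hq2Rep c = [(0,1), dt/(1+t²)] × [(0,1), c·dt/(1+t²)]` (a Fubini product; value `c·π²/16`).
[KontsevichZagier2001 §1.1] -/
def hq2Rep (c : ℚ) : KZ.IntegralRep 2 := (hqRep 1).prod (hqRep c)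

/-- The domain of `hq2Rep c` does not depend on `c`. [definition] -/
theorem hq2Rep_domain (c : ℚ) : (hq2Rep c).domain = (hq2Rep 1).domain := rfl

/-- The integrand of `hq2Rep c`. [definition] -/
theorem hq2Rep_integrand (c : ℚ) (z : Fin 2 → ℝ) : (hq2Rep c).integrand z =
    (1:ℚ) / (1 + z (Fin.castAdd 1 (0 : Fin 1)) ^ 2) * ((c : ℝ) / (1 + z (Fin.natAdd 1 (0 : Fin 1)) ^ 2)) := by
  rw [hq2Rep, KZ.IntegralRep.prod_integrand_eq, KZ.IntegralRep.prodFun_apply, hqRep_integrand,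
    hqRep_integrand]

/-- `[(0,1),h] · [(0,1),c·h] = [hq2Rep c]` in the formal period ring. [KontsevichZagier2001 §4.1] -/
theorem of_hqRep_mul_of_hqRep (c : ℚ) : KZ.of (hqRep 1) * KZ.of (hqRep c) = KZ.of (hq2Rep c) :=
  KZ.of_mul_of _ _

/-- **`value (hq2Rep c) = c·π²/16`.** [KontsevichZagier2001 §1.1, §4.1] -/
theorem value_hq2Rep (c : ℚ) : (hq2Rep c).value = (c : ℝ) * (Real.pi ^ 2 / 16) := by
  rw [hq2Rep, KZ.IntegralRep.value_prod, value_hqRep, value_hqRep]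
  push_cast
  ring

/-- Integrand additivity for the square generator. [KontsevichZagier2001 §1.2 rule (1)] -/
theorem of_hq2Rep_add (c₁ c₂ : ℚ) :
    KZ.of (hq2Rep (c₁ + c₂)) - KZ.of (hq2Rep c₁) - KZ.of (hq2Rep c₂) ∈ KZ.relations :=
  KZ.integrandAddRel_subset_relations ⟨2, hq2Rep (c₁ + c₂), hq2Rep c₁, hq2Rep c₂,
    hq2Rep_domain _ |>.trans (hq2Rep_domain _).symm, hq2Rep_domain _ |>.trans (hq2Rep_domain _).symm,
    fun z _ => by simp only [hq2Rep_integrand, Pi.add_apply, Rat.cast_add]; ring, rfl⟩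

/-! #### The sector, the normal form, values -/

/-- **The generating set of the `π`-polynomial sector `Π`.** [this node] -/
def piGens : Set KZ.FormalRep :=
  (Set.range fun a : ℚ => KZ.of (cstRep a)) ∪ (Set.range fun b : ℚ => KZ.of (hqRep b)) ∪
    (Set.range fun c : ℚ => KZ.of (hq2Rep c))

/-- The normal form `[pt, a] + [(0,1), b/(1+t²)] + [(0,1)², c/((1+x²)(1+y²))]`. [this node] -/
def piNF (a b c : ℚ) : KZ.FormalRep := KZ.of (cstRep a) + KZ.of (hqRep b) + KZ.of (hq2Rep c)

/-- Constants lie in `Π`. [definition] -/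
theorem of_cstRep_mem_piGens (a : ℚ) : KZ.of (cstRep a) ∈ piGens := Or.inl (Or.inl ⟨a, rfl⟩)
/-- Arcs lie in `Π`. [definition] -/
theorem of_hqRep_mem_piGens (b : ℚ) : KZ.of (hqRep b) ∈ piGens := Or.inl (Or.inr ⟨b, rfl⟩)
/-- Squared arcs lie in `Π`. [definition] -/
theorem of_hq2Rep_mem_piGens (c : ℚ) : KZ.of (hq2Rep c) ∈ piGens := Or.inr ⟨c, rfl⟩

/-- The normal form lies in the sector. [this node] -/
theorem piNF_mem_closure (a b c : ℚ) : piNF a b c ∈ AddSubgroup.closure piGens :=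
  add_mem (add_mem (AddSubgroup.subset_closure (of_cstRep_mem_piGens a))
    (AddSubgroup.subset_closure (of_hqRep_mem_piGens b)))
    (AddSubgroup.subset_closure (of_hq2Rep_mem_piGens c))

/-- **Value of the normal form: `a + b·π/4 + c·π²/16`.** [KontsevichZagier2001 §1.1] -/
theorem eval_piNF (a b c : ℚ) :
    KZ.eval (piNF a b c) = (a : ℝ) + (b : ℝ) * (Real.pi / 4) + (c : ℝ) * (Real.pi ^ 2 / 16) := by
  simp only [piNF, map_add, KZ.eval_of, value_cstRep, value_hqRep, value_hq2Rep]

/-- **Additivity of the normal form** modulo relations (three integrand-additivity moves). [KontsevichZagier2001 §1.2 rule (1)] -/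
theorem piNF_add_sub_mem (a₁ b₁ c₁ a₂ b₂ c₂ : ℚ) :
    piNF (a₁ + a₂) (b₁ + b₂) (c₁ + c₂) - (piNF a₁ b₁ c₁ + piNF a₂ b₂ c₂) ∈ KZ.relations := by
  have : piNF (a₁ + a₂) (b₁ + b₂) (c₁ + c₂) - (piNF a₁ b₁ c₁ + piNF a₂ b₂ c₂) =
      (KZ.of (cstRep (a₁ + a₂)) - KZ.of (cstRep a₁) - KZ.of (cstRep a₂)) +
      (KZ.of (hqRep (b₁ + b₂)) - KZ.of (hqRep b₁) - KZ.of (hqRep b₂)) +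
      (KZ.of (hq2Rep (c₁ + c₂)) - KZ.of (hq2Rep c₁) - KZ.of (hq2Rep c₂)) := by
    simp only [piNF]; abel
  rw [this]
  exact add_mem (add_mem (of_cstRep_add _ _) (of_hqRep_add _ _)) (of_hq2Rep_add _ _)

/-- A zero-weight generator is a relation: `z − z − z ≡ 0` is ONE integrand-additivity move. [KontsevichZagier2001 §1.2] -/
theorem mem_relations_of_add_self {z : KZ.FormalRep} (h : z - z - z ∈ KZ.relations) : z ∈ KZ.relations := by
  have e : z - z - z = -z := by abel
  rw [e] at h
  simpa using neg_mem h

/-- `[pt, 0]` is a relation. [KontsevichZagier2001 §1.2] -/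
theorem of_cstRep_zero_mem : KZ.of (cstRep 0) ∈ KZ.relations :=
  mem_relations_of_add_self (by simpa using of_cstRep_add 0 0)

/-- `[(0,1), 0]` is a relation. [KontsevichZagier2001 §1.2] -/
theorem of_hqRep_zero_mem : KZ.of (hqRep 0) ∈ KZ.relations :=
  mem_relations_of_add_self (by simpa using of_hqRep_add 0 0)

/-- `[(0,1)², 0]` is a relation. [KontsevichZagier2001 §1.2] -/
theorem of_hq2Rep_zero_mem : KZ.of (hq2Rep 0) ∈ KZ.relations :=
  mem_relations_of_add_self (by simpa using of_hq2Rep_add 0 0)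

/-- The zero normal form is a relation. [KontsevichZagier2001 §1.2] -/
theorem piNF_zero_mem_relations : piNF 0 0 0 ∈ KZ.relations :=
  add_mem (add_mem of_cstRep_zero_mem of_hqRep_zero_mem) of_hq2Rep_zero_mem

/-- Negation of the normal form modulo relations. [KontsevichZagier2001 §1.2 rule (1)] -/
theorem piNF_neg_add_mem (a b c : ℚ) : piNF (-a) (-b) (-c) + piNF a b c ∈ KZ.relations := by
  have h := piNF_add_sub_mem (-a) (-b) (-c) a b c
  simp only [neg_add_cancel] at h
  have : piNF (-a) (-b) (-c) + piNF a b c =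
      piNF 0 0 0 - (piNF 0 0 0 - (piNF (-a) (-b) (-c) + piNF a b c)) := by abel
  rw [this]
  exact sub_mem piNF_zero_mem_relations h

/-- **Normal form theorem:** every element of `Π` is a normal form modulo relations. [this node] -/
theorem exists_normalForm {x : KZ.FormalRep} (hx : x ∈ AddSubgroup.closure piGens) :
    ∃ a b c : ℚ, x - piNF a b c ∈ KZ.relations := by
  induction hx using AddSubgroup.closure_induction with
  | mem y hy =>
    rcases hy with (⟨a, rfl⟩ | ⟨b, rfl⟩) | ⟨c, rfl⟩
    · refine ⟨a, 0, 0, ?_⟩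
      have e : (fun a : ℚ => KZ.of (cstRep a)) a - piNF a 0 0 = -(KZ.of (hqRep 0) + KZ.of (hq2Rep 0)) := by
        simp only [piNF]; abel
      rw [e]
      exact neg_mem (add_mem of_hqRep_zero_mem of_hq2Rep_zero_mem)
    · refine ⟨0, b, 0, ?_⟩
      have e : (fun b : ℚ => KZ.of (hqRep b)) b - piNF 0 b 0 = -(KZ.of (cstRep 0) + KZ.of (hq2Rep 0)) := by
        simp only [piNF]; abel
      rw [e]
      exact neg_mem (add_mem of_cstRep_zero_mem of_hq2Rep_zero_mem)
    · refine ⟨0, 0, c, ?_⟩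
      have e : (fun c : ℚ => KZ.of (hq2Rep c)) c - piNF 0 0 c = -(KZ.of (cstRep 0) + KZ.of (hqRep 0)) := by
        simp only [piNF]; abel
      rw [e]
      exact neg_mem (add_mem of_cstRep_zero_mem of_hqRep_zero_mem)
  | zero =>
    exact ⟨0, 0, 0, by simpa using neg_mem piNF_zero_mem_relations⟩
  | add y z _ _ hy hz =>
    obtain ⟨a₁, b₁, c₁, h₁⟩ := hy
    obtain ⟨a₂, b₂, c₂, h₂⟩ := hz
    refine ⟨a₁ + a₂, b₁ + b₂, c₁ + c₂, ?_⟩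
    have : y + z - piNF (a₁ + a₂) (b₁ + b₂) (c₁ + c₂) =
        (y - piNF a₁ b₁ c₁) + (z - piNF a₂ b₂ c₂) -
          (piNF (a₁ + a₂) (b₁ + b₂) (c₁ + c₂) - (piNF a₁ b₁ c₁ + piNF a₂ b₂ c₂)) := by abel
    rw [this]
    exact sub_mem (add_mem h₁ h₂) (piNF_add_sub_mem _ _ _ _ _ _)
  | neg y _ hy =>
    obtain ⟨a, b, c, h⟩ := hy
    refine ⟨-a, -b, -c, ?_⟩
    have : -y - piNF (-a) (-b) (-c) = -(y - piNF a b c) - (piNF (-a) (-b) (-c) + piNF a b c) := by abel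
    rw [this]
    exact sub_mem (neg_mem h) (piNF_neg_add_mem a b c)

/-! #### The transcendence input: `1, π, π²` are `ℚ`-linearly independent -/

/-- **`a + b·π/4 + c·π²/16 = 0` with `a, b, c ∈ ℚ` forces `a = b = c = 0`** (`π` is transcendental:
otherwise `π` is a root of the non-zero rational polynomial `a + (b/4)X + (c/16)X²`).
[Lindemann1882 via BakerTNT1975 Thm 1.3] -/
theorem coeffs_eq_zero_of_eval_eq_zero {a b c : ℚ}
    (h : (a : ℝ) + (b : ℝ) * (Real.pi / 4) + (c : ℝ) * (Real.pi ^ 2 / 16) = 0) :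
    a = 0 ∧ b = 0 ∧ c = 0 := by
  by_contra hne
  have hp : (Polynomial.C a + Polynomial.C (b / 4) * Polynomial.X +
      Polynomial.C (c / 16) * Polynomial.X ^ 2 : Polynomial ℚ) ≠ 0 := by
    intro h0
    have e0 := congrArg (fun p : Polynomial ℚ => p.coeff 0) h0
    have e1 := congrArg (fun p : Polynomial ℚ => p.coeff 1) h0
    have e2 := congrArg (fun p : Polynomial ℚ => p.coeff 2) h0
    simp [Polynomial.coeff_X, Polynomial.coeff_C, Polynomial.coeff_X_pow] at e0 e1 e2
    exact hne ⟨e0, by linarith, by linarith⟩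
  have halg : IsAlgebraic ℚ Real.pi := by
    refine ⟨_, hp, ?_⟩
    simp only [map_add, map_mul, map_pow, Polynomial.aeval_C, Polynomial.aeval_X, eq_ratCast,
      Rat.cast_div, Rat.cast_ofNat]
    linear_combination h
  exact transcendental_pi_holds halg

/-! #### The kernel theorem -/

/-- **`piKernel` — Conjecture 1 in kernel form on the `π`-polynomial sector, PROVED:** every
`ℤ`-combination of `[pt, a]`, `[(0,1), b/(1+t²)]`, `[(0,1)², c/((1+x²)(1+y²))]` (`a, b, c ∈ ℚ`) whose value
is `0` lies in `KZ.relations`.  (Normal form by integrand additivity; `1, π, π²` independent by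
Lindemann; zero weights are relations.)  [KontsevichZagier2001 §1.2; Lindemann1882; this node] -/
theorem piKernel : ∀ ⦃x : KZ.FormalRep⦄, x ∈ AddSubgroup.closure piGens → KZ.eval x = 0 →
    x ∈ KZ.relations := by
  intro x hx hv
  obtain ⟨a, b, c, h⟩ := exists_normalForm hx
  have hval : KZ.eval (piNF a b c) = 0 := by
    have hk := KZ.relations_le_ker_eval_holds h
    rw [AddMonoidHom.mem_ker, map_sub, hv, zero_sub, neg_eq_zero] at hk
    exact hk
  rw [eval_piNF] at hval
  obtain ⟨rfl, rfl, rfl⟩ := coeffs_eq_zero_of_eval_eq_zero hval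
  have : x = (x - piNF 0 0 0) + piNF 0 0 0 := by abel
  rw [this]
  exact add_mem h piNF_zero_mem_relations

/-- **Descent form of the kernel theorem** (the shape consumed downstream): a vanishing
`ℤ`-combination of representations each of which descends modulo relations into `Π` is a relation.
[KontsevichZagier2001 §1.2; this node] -/
theorem sum_mem_relations_of_piDescent (k : ℕ) (d : Fin k → ℕ) (ρ : (i : Fin k) → KZ.IntegralRep (d i))
    (c : Fin k → ℤ) (y : Fin k → KZ.FormalRep) (hy : ∀ i, y i ∈ AddSubgroup.closure piGens)
    (hrel : ∀ i, KZ.of (ρ i) - y i ∈ KZ.relations) (hv : KZ.eval (∑ i, c i • KZ.of (ρ i)) = 0) :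
    (∑ i, c i • KZ.of (ρ i)) ∈ KZ.relations := by
  have h1 : (∑ i, c i • KZ.of (ρ i)) - ∑ i, c i • y i ∈ KZ.relations := by
    rw [← Finset.sum_sub_distrib]
    exact AddSubgroup.sum_mem _ fun i _ => by
      rw [← smul_sub]; exact AddSubgroup.zsmul_mem _ (hrel i) _
  have h2 : (∑ i, c i • y i) ∈ AddSubgroup.closure piGens :=
    AddSubgroup.sum_mem _ fun i _ => AddSubgroup.zsmul_mem _ (hy i) _
  have h3 : KZ.eval (∑ i, c i • y i) = 0 := by
    have h := KZ.relations_le_ker_eval_holds h1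
    rw [AddMonoidHom.mem_ker, map_sub, hv, zero_sub, neg_eq_zero] at h
    exact h
  have : (∑ i, c i • KZ.of (ρ i)) = ((∑ i, c i • KZ.of (ρ i)) - ∑ i, c i • y i) + ∑ i, c i • y i := by
    abel
  rw [this]
  exact add_mem h1 (piKernel h2 h3)

end Summit.KontsevichZagierPeriods.RootDecompWalshStrata.PiSector

end
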